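import Mathlib
import Literature.MathematicalPhysics.QuantumFieldTheory.MagnenRivasseauSeneor1993.MRS93ResolventExpansionAlgebra
import HarnessLib

/-!
# Magnen–Rivasseau–Sénéor, *Construction of YM₄ with an infrared cutoff* (CMP 155, 1993), Sect. V.A p.361: the display (V.8)
# «C = 1/Δ⁰_B = C₁₁ + C₁₂ + C₂₁ + C₂₂» and the sentence «we write C(t) = C₁₁ + tC₁₂ + tC₂₁ + C₂₂. This is still a positive
# operator since C₁₁ and C₂₂ are positive. Then we perform a first order Taylor expansion in this parameter» — the algebra of the
# two-sided stopped resolvent expansion PROVED in any ring, and the positivity of the interpolated covariance PROVED for bounded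
# operators on a Hilbert space

non-commutative ring identities for invertible elements, the order structure of bounded self-adjoint operators (Mathlib's
`ContinuousLinearMap.IsPositive`) and first-year calculus; nothing here is a claim about the Yang–Mills mass gap, about continuum
YM₄ on `T⁴` (with or without infrared cutoff), or about the Clay problem — and nothing of the OPERATORS `Δ⁰_B`, `Δ⁰_Δ`, `Γ`, `Γ′`,
`D_ELFR`, `χ_CSFR`, `χ_ELFR` of Sect. V (covariant Laplacians with background field, strings of their propagators, localised
insertions), of the stopping rules, of the error terms, of the change of variables `A → (1 + χ_CSFR Γ′)A`, of (V.9)–(V.13) or of the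
convergence of anything is asserted or formalised: the file checks the LETTER of (V.8) and of the positivity sentence

**Citation header (reproduction of PUBLISHED work).** J. Magnen, V. Rivasseau, R. Sénéor, *Construction of YM₄ with an infrared
cutoff*, Commun. Math. Phys. **155** (1993) 325–383 [MagnenRivasseauSeneor1993], Sect. V «The Small Field Versus Large Field
Expansion», A) p.361 [PDF 37] tl.2–13 with the display (V.8) (tl.4–6); EDITION v1.1: B) p.362 (V.9), p.363 tl.29–40 with (V.12). Loci
«p.NNN [PDF nn] tl.k» = journal page ∕ PDF page (= journal page − 324) ∕ TEXT-LAYER line of the held scan (the running head is tl.1), as in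
this seat's other files (EDITION v1.2 replaces v1's looser «lines k» counts by these); the display and the sentences were read on a fresh 2×
decode of the page image of
the held Project-Euclid scan `paper:magnen1993-cmp155-mrs-ym4-infrared-cutoff`,
`run/shared/lean/pub/pub-balaban-gaps/pub-balaban-gaps-mrs-lit-2/g20/renders/p37_crop_r300-2700_s2.png` (renderer of record
`run/shared/lean/pub/lit-balaban/inprint/lit-balaban-p14/renders-cmp155/tools/render.py`; the text layer garbles the display). Cell
pub-balaban-gaps (YM blitz, track G3 «MRS 1993 typed AS PRINTED»), seat mrs-lit-2 (gen 20, file 56); companion record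
`run/shared/lean/pub/pub-balaban-gaps/g3/MRS-AS-PRINTED-estimates.md` (§7 listed (V.8) among the displays NOT covered — «definitions ∕
derivation steps»; this file covers its algebra and the one estimate-like sentence after it). Imports this seat's file 52
`MRS93ResolventExpansionAlgebra` ((V.1), (V.4), (V.6) as ring identities: `ResolventExpansion.inv_eq_sandwich`,
`inv_eq_inv_mul_one_add`, `inv_eq_add_one_mul_inv`) and re-declares nothing of it. The interpolation device itself is textbook: the
decoupling covariances of a cluster expansion «are convex combinations of the operators C_Γ … (18.2.3) is a convex sum»
[GlimmJaffeQP1987, §18.2 (18.2.1)–(18.2.3)], «a convex combination of functions of positive type» [Rivasseau1991, §III.1.B p.154];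
the tree has the n-cluster Brydges–Battle–Federbush version for finite-dimensional covariances
(`Literature.Probability.LatticeModels.BattleFederbushCovariance`, `posSemidef_covInterp`). What is typed here is MRS's two-piece,
operator-level sentence together with the (V.8) algebra that makes `C(1) = C`; nothing of those files is restated.

**What the paper prints (verbatim, from the page image).** p.361 [PDF 37] tl.2–13: *«If we apply this process symmetrically on Δ
and Δ′, i.e. at both ends of (V.6), we obtain the covariance in the form*
*C = 1/Δ⁰_B = C₁₁ + C₁₂ + C₂₁ + C₂₂,  C₁₁ = χ_CSFR Γ Δ⁰_B Γ χ_CSFR;  C₁₂ = χ_CSFR Γ[Γ′χ_CSFR + χ_ELFR],  C₂₁ = [χ_CSFR Γ′ + χ_ELFR]Γ χ_CSFR,*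
*C₂₂ = [χ_CSFR Γ′ + χ_ELFR] (1/Δ⁰_B) [Γ′χ_CSFR + χ_ELFR],  (V.8)*
*where Γ is some string of propagators each corresponding to a constant background field (with insertions of ∇B′_l or of momentum
violating terms) and Γ′ = ΓD_ELFR, where D_ELFR is an insertion explicitly localized in some box of ELFR of scale j. Then we introduce
an interpolation parameter t ∈ [0,1] which at t = 0 suppresses the coupling pieces C₁₂ and C₂₁. Hence we write C(t) = C₁₁ + tC₁₂ +
tC₂₁ + C₂₂. This is still a positive operator since C₁₁ and C₂₂ are positive. Then we perform a first order Taylor expansion in this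
parameter.»* (p.359 (V.6), typed in file 52: *«1/Δ⁰_B = Σ Σ χ_Δ κ^j (1/Δ⁰_Δ [1 + (Δ⁰_Δ − Δ⁰_B) 1/Δ⁰_B]) Δ⁰_B ([1/Δ⁰_B (Δ⁰_{Δ′} − Δ⁰_B)
+ 1] 1/Δ⁰_{Δ′}) κ^{j′} χ_{Δ′}»*; p.360 tl.22–23: *«the expansion step (V.6) is reiterated on 1/Δ⁰_B with Δ replaced by Δ″»*;
tl.28–29: *«When any of these terms is chosen we stop the expansion.»*)

Sect. V.B pp.362–363 [PDF 38–39] (page images re-decoded at 2×, `g20/renders/p38_crop_r2900-5000_s2.png`, `p39_crop_r3700-5700_s2.png`):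
*«We start with χ_ELFR (1/Δ⁰_B) χ_ELFR [see (V.8)]. We want to decouple a first large field region, say E₁, from the rest. We insert a first
resolvent step which is χ_ELFR (1/Δ⁰_B) = χ_ELFR [1/Δ_B^{0,∅} + (1/Δ_B^{0,∅})(Δ_B^{0,∅} − Δ⁰_B)(1/Δ⁰_B)]. (V.9)»* (p.362 tl.24–28); p.363 tl.29–40: *«A
second possibility, instead of expanding (V.10–11) to infinity, is to test inductively the coupling of E₁ to E₂ ∪ … ∪ E_n and to iterate.
This generates only one link at a time, hence prevents the accumulation of background fields. But this process requires interpolation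
parameters á la Brydges-Battle-Federbush, and we need to do it symmetrically from both sides of C₂₂ in order to preserve positivity.
This is done by applying (V.9) for i = 1 on both sides of 1/Δ⁰_B as in (V.6). We give the corresponding result on one side for
simplicity: χ₁ (1/Δ⁰_B) = χ₁ [1/Δ_B^{0,∅} + (1/Δ_B^{0,1})(Δ_B^{0,∅} − Δ_B^{0,1})(1/Δ_B^{0,∅}) + (1/Δ_B^{0,∅})(Δ_B^{0,1} − Δ⁰_B)(1/Δ⁰_B)
+ (1/Δ_B^{0,1})(Δ_B^{0,∅} − Δ_B^{0,1})(1/Δ_B^{0,∅})(Δ_B^{0,ı} − Δ⁰_B)(1/Δ⁰_B)]. (V.12)»* [sic: the last difference is printed with the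
superscript «0,ı»; it is «Δ_B^{0,1} − Δ⁰_B» as in the third term — the identity below holds with that reading and fails otherwise]
*«Then we multiply the differences Δ_B^{0,1} − Δ⁰_B by an interpolation parameter s₁, Taylor expand to first order, decompose the
remainder term as a sum over χ_j, j ≠ 1 and iterating, with E₁ and E_j joined together, and iterate.»*

**What is formalised (every statement below is a `theorem` with its proof; no definition, no predicate taken as hypothesis).**
* §1 THE ALGEBRA OF (V.8), in any ring `R`, inverses as units. A STOPPED LEFT EXPANSION of `B⁻¹ = 1/Δ⁰_B` is an identity
  `B⁻¹ = X + Y·B⁻¹` («good» strings `X = χ_CSFR Γ` ending in the small field region, stopped strings `Y = χ_CSFR Γ′ + χ_ELFR` still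
  followed by the full propagator); a stopped RIGHT expansion is `B⁻¹ = X̃ + B⁻¹·Ỹ`. **`two_sided_expansion`**: the two together give
  `B⁻¹ = X B X̃ + X Ỹ + Y X̃ + Y B⁻¹ Ỹ` — the four pieces of (V.8) («symmetrically on Δ and Δ′, i.e. at both ends»), via file 52's
  sandwich `B⁻¹ = B⁻¹ B B⁻¹`; **`displayV8`** is the same with the pieces named `C₁₁, C₁₂, C₂₁, C₂₂`. Where such expansions come
  from: **`left_stopped_expansion`** ∕ **`right_stopped_expansion`** — ONE step (V.6) around `A = Δ⁰_Δ` with a partition of unity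
  `P + Q = 1` (`P = χ_CSFR`, `Q = χ_ELFR`) gives `X = PΓ`, `Y = PΓ′ + Q` with `Γ = A⁻¹`, `Γ′ = Γ(A − B)` (and mirror images on the
  right), i.e. literally the printed shape with a one-propagator string; **`left_stopped_compose`** — reiterating on part of the
  remainder keeps the shape `X + Y·B⁻¹` («the process is then reiterated … until finally it stops»), so `two_sided_expansion` covers
  «some string of propagators»; **`displayV8_oneStep`** assembles the one-step case.
* §2 THE INTERPOLATION `C(t) = C₁₁ + tC₁₂ + tC₂₁ + C₂₂` in any module: `interp_zero` (`t = 0` «suppresses the coupling pieces»: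
  `C(0) = C₁₁ + C₂₂`), `interp_one` (`C(1) = C₁₁ + C₁₂ + C₂₁ + C₂₂`), **`interp_eq_convex`** (`C(t) = (1 − t)(C₁₁ + C₂₂) + t·C(1)` — the
  identity behind the positivity sentence), `interp_eq_affine` (`C(t) = (C₁₁ + C₂₂) + t(C₁₂ + C₂₁)`).
* §3 «THIS IS STILL A POSITIVE OPERATOR», for bounded operators on a Hilbert space over `𝕜 = ℝ` or `ℂ` (`ContinuousLinearMap.IsPositive`,
  i.e. self-adjoint with `⟪Tx, x⟫ ≥ 0`): **`isPositive_interp`** — if `C = C₁₁ + C₁₂ + C₂₁ + C₂₂`, `C`, `C₁₁`, `C₂₂` are positive and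
  `0 ≤ t ≤ 1` then `C(t)` is positive; the MRS instance **`isPositive_interp_of_stoppedExpansion`**: for a positive invertible `B`
  (so `C = B⁻¹` is positive, `isPositive_units_inv`) and ANY stopped left expansion `B⁻¹ = X + Y B⁻¹`, the symmetric right expansion is
  its adjoint `B⁻¹ = X† + B⁻¹Y†` (`right_of_left_star`, «symmetrically on Δ and Δ′»), `C₁₁ = X B X†` and `C₂₂ = Y B⁻¹ Y†` are positive
  (`isPositive_C11`, `isPositive_C22`), `C₂₁ = C₁₂†` (`star_C12`), and `C(t) = XBX† + t·XY† + t·YX† + YB⁻¹Y†` IS POSITIVE for every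
  `t ∈ [0, 1]`. `interp_neg_example`: already for `1 × 1` real data the same expression is negative at `t = −2`, so the interval matters.
* §4 «A FIRST ORDER TAYLOR EXPANSION IN THIS PARAMETER»: `hasDerivAt_interp` (`t ↦ C(t)` has derivative `C₁₂ + C₂₁` everywhere, in any
  normed space), `interp_one_eq_zero_add` (`C(1) = C(0) + (C₁₂ + C₂₁)`), and the scalar form in which a Gaussian functional of `C(t)` is
  expanded, `taylor_first_order` (`g(1) = g(0) + ∫₀¹ g′(t) dt` for `g` differentiable on `[0,1]` with integrable derivative — Mathlib's
  fundamental theorem of calculus; «the interpolating terms contain an explicit C₁₂ or C₂₁ link» is the factor `C′(t) = C₁₂ + C₂₁`).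
* §5 (EDITION v1.1) SECT. V.B, (V.9) ∕ (V.12) AND «SYMMETRICALLY FROM BOTH SIDES OF C₂₂ IN ORDER TO PRESERVE POSITIVITY»: **`displayV9`**
  (one resolvent step around `Δ_B^{0,∅}`), `inv_two_step` (`1/Δ_B^{0,1} = 1/Δ_B^{0,∅} + (1/Δ_B^{0,1})(Δ_B^{0,∅} − Δ_B^{0,1})(1/Δ_B^{0,∅})`),
  **`displayV12`** (the four printed terms, in any ring) and `displayV12_eq_twoFactor` (they are `[1/Δ_B^{0,1}]·[1 + (Δ_B^{0,1} − Δ⁰_B)(1/Δ⁰_B)]`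
  with the first factor expanded around `Δ_B^{0,∅}`); the `s₁`-interpolation «multiply the differences Δ_B^{0,1} − Δ⁰_B by s₁»:
  **`sInterp_eq_convex`** — the interpolated one-sided bracket is `(1 − s₁)·(1/Δ_B^{0,1}) + s₁·(1/Δ⁰_B)` (in any algebra), `sInterp_zero` ∕
  `sInterp_one`, `hasDerivAt_sInterp` (derivative `1/Δ⁰_B − 1/Δ_B^{0,1} = (1/Δ_B^{0,1})(Δ_B^{0,1} − Δ⁰_B)(1/Δ⁰_B)` — the first-order Taylor
  remainder carries the difference); positivity for Hilbert-space operators: **`isPositive_symmetric_sandwich`** (applied «on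
  both sides», `L · Δ⁰_B · L†` is positive for EVERY bounded `L`, in particular for the interpolated bracket at every real `s₁`) and
  `isPositive_sInterp` (the one-sided convex combination is positive too, but only for `s₁ ∈ [0,1]`, given `Δ_B^{0,1}`, `Δ⁰_B` positive invertible).

**EDITION v1.1 (same seat, gen 20; ADD-ONLY — every v1 declaration byte-identical, no import change):** §5 = Sect. V.B's displays (V.9),
(V.12) as ring identities (with the printed «Δ_B^{0,ı}» of (V.12)'s last factor read as «Δ_B^{0,1}», recorded) and the sentence «we need
to do it symmetrically from both sides of C₂₂ in order to preserve positivity … Then we multiply the differences Δ_B^{0,1} − Δ⁰_B by an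
interpolation parameter s₁, Taylor expand to first order» — the interpolated bracket is the convex combination `(1 − s₁)/Δ_B^{0,1} +
s₁/Δ⁰_B`, its `s₁`-derivative is the difference term, and the symmetric sandwich is a positive operator for every `s₁`. NOT claimed: the
operators `Δ_B^{0,∅}`, `Δ_B^{0,i}`, `Δ_B`, the chains (V.10) («formally»), the interaction (V.11), [DMR]'s scenario, any convergence.

**EDITION v1.2 (same seat, gen 20; DOCSTRINGS ONLY — every declaration of v1.1 byte-identical, no import change):** the page
locators of this file are now TEXT-LAYER line numbers «tl.k» of the held scan (running head = tl.1), uniformly with the seat's other files: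
p.361 «If we apply … in the form» tl.2–3, (V.8) tl.4–6, «where Γ … scale j» tl.7–9, «Then we introduce … suppresses» tl.10, «Hence we write
C(t) = …» tl.11, «This is still a positive operator since C₁₁ and C₂₂ are positive. Then we perform a» tl.12, «first order Taylor expansion
in this parameter» tl.13, «The interpolating terms contain an explicit C₁₂ or C₂₁ link» tl.14, «The process is then reiterated … exhaustion
of all boxes in CSFR» tl.17–20; p.360 «the expansion step (V.6) is reiterated» tl.22–23, «When any of these terms is chosen we stop the
expansion» tl.28–29; p.362 (V.9) tl.24–28; p.363 «A second possibility …» tl.29, «symmetrically from both sides of C₂₂ in order to preserve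
positivity» tl.33, «applying (V.9) for i = 1 on both sides» tl.34, (V.12) tl.36–37, «Then we multiply the differences … s₁, Taylor expand
to first order … iterate» tl.38–40 (v1 ∕ v1.1 had printed looser «lines k» counts, some off by up to three lines). Nothing else moves.

**Reading conventions (declared).** (i) As in file 52, «1/Δ⁰_B», «1/Δ⁰_Δ» are INVERSES OF UNITS of an abstract ring (§1) or of the
ring `E →L[𝕜] E` of bounded operators (§3); invertibility and (in §3) positivity of `Δ⁰_B` are HYPOTHESES (`B` a unit, `IsPositive B`)
— in the paper `Δ⁰_B` is a positive covariant Laplacian with cutoffs, which this file does not construct. (ii) «Γ is some string of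
propagators», «Γ′ = ΓD_ELFR»: typed through the stopped-expansion identities `B⁻¹ = X + Y B⁻¹` they produce (§1), not as explicit
products; the one-step theorems show the printed letters arise with `Γ = 1/Δ⁰_Δ`. On the right of (V.8) the paper writes the same
letters `Γ`, `Γ′` for the mirror-image strings; here the right data are separate variables `X̃, Ỹ`, equal to the adjoints `X†, Y†` in
§3 («symmetrically»). (iii) «positive operator» = Mathlib's `ContinuousLinearMap.IsPositive` (symmetric and `0 ≤ re⟪Tx, x⟫`) on a
Hilbert space over `RCLike 𝕜`; real `t` acts as the scalar `(t : 𝕜)`. (iv) The kernel proof of the positivity sentence uses, besides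
«C₁₁ and C₂₂ are positive», the first line of (V.8) — `C(1) = C = 1/Δ⁰_B` is positive — through the convex-combination identity
`C(t) = (1 − t)(C₁₁ + C₂₂) + tC`; this is recorded as the reading of the printed «since», not as a correction (§3's `interp_neg_example`
only shows that `t ∈ [0,1]` is used).

**What is NOT claimed.** The operators of Sect. V and their kernels; that MRS's actual `Γ`-strings are the adjoints of each other
beyond the formal symmetry used here; the five error terms of (V.7) and their small factors; the stopping rules («five error terms»,
ELFR couplings, «more than five low momentum background fields»); footnote 6 (the `D_ELFR` insertion versus `χ_ELFR`); the change of
variables `A → (1 + χ_CSFR Γ′)A` and the «more complicated interaction»; (V.9)–(V.13) (Sect. V.B); the Gaussian measures `dμ_{C(t)}`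
themselves and the derivative formula for them (the tree's `Literature.Probability.Distributions.GaussianInterpolationFormula` is the
finite-dimensional statement; not imported); any convergence. MRS work at FIXED INFRARED CUTOFF in finite volume: nothing here bears
on infinite volume or a mass gap, and nothing on Bałaban's papers.
-/

noncomputable section

open MeasureTheory

namespace Literature.MathematicalPhysics.QuantumFieldTheory.MagnenRivasseauSeneor1993

namespace Decoupling

/-! ## §1 (V.8): the two-sided stopped resolvent expansion, in any ring -/

section Algebra

variable {R : Type*} [Ring R]

/-- **(V.8), first line** p.361 [PDF 37]: *«If we apply this process symmetrically on Δ and Δ′, i.e. at both ends of (V.6), we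
obtain the covariance in the form C = 1/Δ⁰_B = C₁₁ + C₁₂ + C₂₁ + C₂₂»* — the algebra: a stopped LEFT expansion `B⁻¹ = X + Y B⁻¹`
and a stopped RIGHT expansion `B⁻¹ = X̃ + B⁻¹ Ỹ` of the same inverse combine, through the sandwich `B⁻¹ = B⁻¹ B B⁻¹` of (V.4),
into `B⁻¹ = X B X̃ + X Ỹ + Y X̃ + Y B⁻¹ Ỹ` (the printed `C₁₁ = χΓ Δ⁰_B Γχ`, `C₁₂ = χΓ[Γ′χ + χ_E]`, `C₂₁ = [χΓ′ + χ_E]Γχ`,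
`C₂₂ = [χΓ′ + χ_E](1/Δ⁰_B)[Γ′χ + χ_E]` with `X = χΓ`, `Y = χΓ′ + χ_E` and their mirror images).
[cite: MagnenRivasseauSeneor1993, Sect. V (V.8) p.361; (V.4), (V.6) p.359] -/
theorem two_sided_expansion (B : Rˣ) {X Y X' Y' : R} (hL : (↑B⁻¹ : R) = X + Y * ↑B⁻¹)
    (hR : (↑B⁻¹ : R) = X' + ↑B⁻¹ * Y') :
    (↑B⁻¹ : R) = X * B * X' + X * Y' + Y * X' + Y * ↑B⁻¹ * Y' := by
  have key : (X + Y * ↑B⁻¹) * (B : R) * (X' + ↑B⁻¹ * Y') = X * B * X' + X * Y' + Y * X' + Y * ↑B⁻¹ * Y' := by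
    simp only [add_mul, mul_add, mul_assoc, Units.inv_mul_cancel_left, Units.mul_inv_cancel_left]
    abel
  rw [← key, ← hL, ← hR]
  exact ResolventExpansion.inv_eq_sandwich B

/-- **(V.8)** with the printed names: if `C₁₁ = X B X̃`, `C₁₂ = X Ỹ`, `C₂₁ = Y X̃`, `C₂₂ = Y B⁻¹ Ỹ` for a stopped left ∕ right
expansion pair of `C = B⁻¹ = 1/Δ⁰_B`, then *«C = 1/Δ⁰_B = C₁₁ + C₁₂ + C₂₁ + C₂₂»*. [cite: MagnenRivasseauSeneor1993, Sect. V (V.8) p.361] -/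
theorem displayV8 (B : Rˣ) {X Y X' Y' C₁₁ C₁₂ C₂₁ C₂₂ : R} (hL : (↑B⁻¹ : R) = X + Y * ↑B⁻¹)
    (hR : (↑B⁻¹ : R) = X' + ↑B⁻¹ * Y') (h11 : C₁₁ = X * B * X') (h12 : C₁₂ = X * Y') (h21 : C₂₁ = Y * X')
    (h22 : C₂₂ = Y * ↑B⁻¹ * Y') : (↑B⁻¹ : R) = C₁₁ + C₁₂ + C₂₁ + C₂₂ := by
  rw [h11, h12, h21, h22]
  exact two_sided_expansion B hL hR

/-- ONE STEP (V.6) on the left, stopped: with a partition of unity `P + Q = 1` (`P = χ_CSFR`, `Q = χ_ELFR`) and the box operator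
`A = Δ⁰_Δ`, `B⁻¹ = PΓ + (PΓ′ + Q)B⁻¹` where `Γ = A⁻¹` and `Γ′ = Γ(A − B)` — the printed shape `X = χ_CSFR Γ`, `Y = χ_CSFR Γ′ + χ_ELFR`
with a one-propagator string (file 52's `inv_eq_inv_mul_one_add`: `B⁻¹ = A⁻¹[1 + (A − B)B⁻¹]`).
[cite: MagnenRivasseauSeneor1993, Sect. V (V.6) p.359, (V.8) p.361] -/
theorem left_stopped_expansion (A B : Rˣ) {P Q : R} (hPQ : P + Q = 1) :
    (↑B⁻¹ : R) = P * ↑A⁻¹ + (P * (↑A⁻¹ * ((A : R) - B)) + Q) * ↑B⁻¹ := by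
  have h1 : (↑B⁻¹ : R) = (P + Q) * ↑B⁻¹ := by rw [hPQ, one_mul]
  have h2 : P * (↑B⁻¹ : R) = P * ↑A⁻¹ + P * (↑A⁻¹ * ((A : R) - B)) * ↑B⁻¹ := by
    conv_lhs => rw [ResolventExpansion.inv_eq_inv_mul_one_add A B]
    rw [mul_add, mul_one, mul_add, ← mul_assoc, ← mul_assoc, mul_assoc P]
  rw [add_mul, ← add_assoc, ← h2, ← add_mul, hPQ, one_mul]

/-- ONE STEP (V.6) on the right, stopped: `B⁻¹ = Γ̃P + B⁻¹(Γ̃′P + Q)` with `Γ̃ = A′⁻¹`, `Γ̃′ = (A′ − B)Γ̃` — the mirror image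
(`[Γ′χ_CSFR + χ_ELFR]` on the right of (V.8)), from file 52's `inv_eq_add_one_mul_inv`: `B⁻¹ = [B⁻¹(A′ − B) + 1]A′⁻¹`.
[cite: MagnenRivasseauSeneor1993, Sect. V (V.6) p.359, (V.8) p.361] -/
theorem right_stopped_expansion (A' B : Rˣ) {P Q : R} (hPQ : P + Q = 1) :
    (↑B⁻¹ : R) = ↑A'⁻¹ * P + ↑B⁻¹ * (((A' : R) - B) * ↑A'⁻¹ * P + Q) := by
  have h2 : (↑B⁻¹ : R) * P = ↑A'⁻¹ * P + ↑B⁻¹ * (((A' : R) - B) * ↑A'⁻¹ * P) := by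
    conv_lhs => rw [ResolventExpansion.inv_eq_add_one_mul_inv A' B]
    rw [add_mul, one_mul, add_mul, add_comm, mul_assoc, mul_assoc, mul_assoc]
  rw [mul_add, ← add_assoc, ← h2, ← mul_add, hPQ, mul_one]

/-- «The process is then reiterated on the remaining 1/Δ⁰_B factor … until finally it stops» (p.361 tl.17–20; p.360 tl.
22–23): expanding further a PART `Z·B⁻¹` of the remainder of a stopped left expansion by another stopped left expansion keeps the
shape — if `B⁻¹ = X₁ + Y₁B⁻¹ + Z₁B⁻¹` and `B⁻¹ = X₂ + Y₂B⁻¹` then `B⁻¹ = (X₁ + Z₁X₂) + (Y₁ + Z₁Y₂)B⁻¹`; so after any finite number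
of steps the expansion is again of the form `X + Y B⁻¹` to which `two_sided_expansion` applies («Γ is some string of propagators»).
[cite: MagnenRivasseauSeneor1993, Sect. V p.360 tl.22–23, p.361 tl.17–20] -/
theorem left_stopped_compose (B : Rˣ) {X₁ Y₁ Z₁ X₂ Y₂ : R} (h1 : (↑B⁻¹ : R) = X₁ + Y₁ * ↑B⁻¹ + Z₁ * ↑B⁻¹)
    (h2 : (↑B⁻¹ : R) = X₂ + Y₂ * ↑B⁻¹) :
    (↑B⁻¹ : R) = (X₁ + Z₁ * X₂) + (Y₁ + Z₁ * Y₂) * ↑B⁻¹ := by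
  have h3 : Z₁ * (↑B⁻¹ : R) = Z₁ * X₂ + Z₁ * Y₂ * ↑B⁻¹ := by
    conv_lhs => rw [h2]
    rw [mul_add, mul_assoc]
  calc (↑B⁻¹ : R) = X₁ + Y₁ * ↑B⁻¹ + Z₁ * ↑B⁻¹ := h1
    _ = X₁ + Y₁ * ↑B⁻¹ + (Z₁ * X₂ + Z₁ * Y₂ * ↑B⁻¹) := by rw [h3]
    _ = (X₁ + Z₁ * X₂) + (Y₁ + Z₁ * Y₂) * ↑B⁻¹ := by rw [add_mul]; abel

/-- The mirror statement for stopped right expansions: `B⁻¹ = X₁ + B⁻¹Y₁ + B⁻¹Z₁` and `B⁻¹ = X₂ + B⁻¹Y₂` give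
`B⁻¹ = (X₁ + X₂Z₁) + B⁻¹(Y₁ + Y₂Z₁)`. [cite: MagnenRivasseauSeneor1993, Sect. V p.361 tl.2–3, 17–20] -/
theorem right_stopped_compose (B : Rˣ) {X₁ Y₁ Z₁ X₂ Y₂ : R} (h1 : (↑B⁻¹ : R) = X₁ + ↑B⁻¹ * Y₁ + ↑B⁻¹ * Z₁)
    (h2 : (↑B⁻¹ : R) = X₂ + ↑B⁻¹ * Y₂) :
    (↑B⁻¹ : R) = (X₁ + X₂ * Z₁) + ↑B⁻¹ * (Y₁ + Y₂ * Z₁) := by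
  have h3 : (↑B⁻¹ : R) * Z₁ = X₂ * Z₁ + ↑B⁻¹ * (Y₂ * Z₁) := by
    conv_lhs => rw [h2]
    rw [add_mul, mul_assoc]
  calc (↑B⁻¹ : R) = X₁ + ↑B⁻¹ * Y₁ + ↑B⁻¹ * Z₁ := h1
    _ = X₁ + ↑B⁻¹ * Y₁ + (X₂ * Z₁ + ↑B⁻¹ * (Y₂ * Z₁)) := by rw [h3]
    _ = (X₁ + X₂ * Z₁) + ↑B⁻¹ * (Y₁ + Y₂ * Z₁) := by rw [mul_add]; abel

/-- **(V.8) after ONE step at each end** («at both ends of (V.6)»): with `P + Q = 1`, `Γ = 1/Δ⁰_Δ = A⁻¹` on the left,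
`Γ̃ = 1/Δ⁰_{Δ′} = A′⁻¹` on the right, `Γ′ = Γ(A − B)`, `Γ̃′ = (A′ − B)Γ̃`:
`B⁻¹ = [PΓ] B [Γ̃P] + [PΓ][Γ̃′P + Q] + [PΓ′ + Q][Γ̃P] + [PΓ′ + Q] B⁻¹ [Γ̃′P + Q]` — the printed four pieces for one-propagator
strings. [cite: MagnenRivasseauSeneor1993, Sect. V (V.6) p.359, (V.8) p.361] -/
theorem displayV8_oneStep (A A' B : Rˣ) {P Q : R} (hPQ : P + Q = 1) :
    (↑B⁻¹ : R) =
      (P * ↑A⁻¹) * B * (↑A'⁻¹ * P) + (P * ↑A⁻¹) * (((A' : R) - B) * ↑A'⁻¹ * P + Q) +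
        (P * (↑A⁻¹ * ((A : R) - B)) + Q) * (↑A'⁻¹ * P) +
          (P * (↑A⁻¹ * ((A : R) - B)) + Q) * ↑B⁻¹ * (((A' : R) - B) * ↑A'⁻¹ * P + Q) :=
  two_sided_expansion B (left_stopped_expansion A B hPQ) (right_stopped_expansion A' B hPQ)

end Algebra

/-! ## §1b «symmetrically on Δ and Δ′»: in a star ring the right expansion is the adjoint of the left one -/

section Star

variable {R : Type*} [Ring R] [StarRing R]

/-- The inverse of a self-adjoint unit is self-adjoint. [cite: MagnenRivasseauSeneor1993, Sect. V (V.8) p.361] -/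
theorem star_units_inv (B : Rˣ) (hB : star (B : R) = B) : star (↑B⁻¹ : R) = ↑B⁻¹ := by
  have h : star (↑B⁻¹ : R) * (B : R) = 1 := by
    conv_lhs => rw [← hB]
    rw [← star_mul, Units.mul_inv, star_one]
  exact (Units.inv_eq_of_mul_eq_one_left h).symm

/-- «If we apply this process symmetrically on Δ and Δ′»: for self-adjoint `B`, the adjoint of a stopped left expansion
`B⁻¹ = X + Y B⁻¹` is the stopped right expansion `B⁻¹ = X† + B⁻¹ Y†`. [cite: MagnenRivasseauSeneor1993, Sect. V (V.8) p.361 tl.2–3] -/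
theorem right_of_left_star (B : Rˣ) (hB : star (B : R) = B) {X Y : R} (hL : (↑B⁻¹ : R) = X + Y * ↑B⁻¹) :
    (↑B⁻¹ : R) = star X + ↑B⁻¹ * star Y := by
  have h := congrArg star hL
  rwa [star_units_inv B hB, star_add, star_mul, star_units_inv B hB] at h

/-- `C₂₁ = C₁₂†`: with symmetric data the two coupling pieces are adjoint to each other, `(X Y†)† = Y X†`.
[cite: MagnenRivasseauSeneor1993, Sect. V (V.8) p.361] -/
theorem star_C12 (X Y : R) : star (X * star Y) = Y * star X := by
  rw [star_mul, star_star]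

/-- `C₁₁ = X B X†` is self-adjoint when `B` is. [cite: MagnenRivasseauSeneor1993, Sect. V (V.8) p.361] -/
theorem star_C11 (B : Rˣ) (hB : star (B : R) = B) (X : R) : star (X * B * star X) = X * B * star X := by
  rw [star_mul, star_mul, star_star, hB, mul_assoc]

/-- `C₂₂ = Y B⁻¹ Y†` is self-adjoint when `B` is. [cite: MagnenRivasseauSeneor1993, Sect. V (V.8) p.361] -/
theorem star_C22 (B : Rˣ) (hB : star (B : R) = B) (Y : R) : star (Y * ↑B⁻¹ * star Y) = Y * ↑B⁻¹ * star Y := by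
  rw [star_mul, star_mul, star_star, star_units_inv B hB, mul_assoc]

end Star

/-! ## §2 «C(t) = C₁₁ + tC₁₂ + tC₂₁ + C₂₂»: the interpolation is a convex combination of `C(0) = C₁₁ + C₂₂` and `C(1) = C` -/

section Interp

variable {S V : Type*} [CommRing S] [AddCommGroup V] [Module S V]

/-- «an interpolation parameter t ∈ [0,1] which at t = 0 suppresses the coupling pieces C₁₂ and C₂₁»: `C(0) = C₁₁ + C₂₂`.
[cite: MagnenRivasseauSeneor1993, Sect. V p.361 tl.10–12] -/
theorem interp_zero (C₁₁ C₁₂ C₂₁ C₂₂ : V) : C₁₁ + (0 : S) • C₁₂ + (0 : S) • C₂₁ + C₂₂ = C₁₁ + C₂₂ := by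
  simp

/-- `C(1) = C₁₁ + C₁₂ + C₂₁ + C₂₂ = C` (the first line of (V.8)). [cite: MagnenRivasseauSeneor1993, Sect. V (V.8) p.361] -/
theorem interp_one (C₁₁ C₁₂ C₂₁ C₂₂ : V) : C₁₁ + (1 : S) • C₁₂ + (1 : S) • C₂₁ + C₂₂ = C₁₁ + C₁₂ + C₂₁ + C₂₂ := by
  simp

/-- **The identity behind «This is still a positive operator»**: `C(t) = (1 − t)·(C₁₁ + C₂₂) + t·(C₁₁ + C₁₂ + C₂₁ + C₂₂)`, a convex
combination of `C(0)` and `C(1) = C` when `t ∈ [0,1]`. [cite: MagnenRivasseauSeneor1993, Sect. V p.361 tl.10–12] -/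
theorem interp_eq_convex (t : S) (C₁₁ C₁₂ C₂₁ C₂₂ : V) :
    C₁₁ + t • C₁₂ + t • C₂₁ + C₂₂ = (1 - t) • (C₁₁ + C₂₂) + t • (C₁₁ + C₁₂ + C₂₁ + C₂₂) := by
  simp only [sub_smul, one_smul, smul_add]
  abel

/-- `C(t)` is affine in `t`: `C(t) = (C₁₁ + C₂₂) + t·(C₁₂ + C₂₁)`. [cite: MagnenRivasseauSeneor1993, Sect. V p.361 tl.10–12] -/
theorem interp_eq_affine (t : S) (C₁₁ C₁₂ C₂₁ C₂₂ : V) :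
    C₁₁ + t • C₁₂ + t • C₂₁ + C₂₂ = (C₁₁ + C₂₂) + t • (C₁₂ + C₂₁) := by
  simp only [smul_add]
  abel

end Interp

/-! ## §3 «This is still a positive operator since C₁₁ and C₂₂ are positive» — bounded operators on a Hilbert space -/

section Positive

open scoped InnerProduct ComplexOrder

variable {𝕜 E : Type*} [RCLike 𝕜] [NormedAddCommGroup E] [InnerProductSpace 𝕜 E] [CompleteSpace E]

omit [CompleteSpace E] in
/-- **«This is still a positive operator»**, abstract form: if `C = C₁₁ + C₁₂ + C₂₁ + C₂₂` with `C`, `C₁₁`, `C₂₂` positive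
(self-adjoint, `⟪Tx, x⟫ ≥ 0`), then `C(t) = C₁₁ + tC₁₂ + tC₂₁ + C₂₂` is positive for every `t ∈ [0,1]` — by `interp_eq_convex`.
The hypothesis on `C` is the first line of (V.8) (`C = 1/Δ⁰_B`, a covariance); see the module docstring, reading (iv).
[cite: MagnenRivasseauSeneor1993, Sect. V p.361 tl.10–12; (V.8)] -/
theorem isPositive_interp {C C₁₁ C₁₂ C₂₁ C₂₂ : E →L[𝕜] E} (hsum : C = C₁₁ + C₁₂ + C₂₁ + C₂₂) (hC : C.IsPositive)
    (h11 : C₁₁.IsPositive) (h22 : C₂₂.IsPositive) {t : ℝ} (ht0 : 0 ≤ t) (ht1 : t ≤ 1) :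
    (C₁₁ + (t : 𝕜) • C₁₂ + (t : 𝕜) • C₂₁ + C₂₂).IsPositive := by
  rw [interp_eq_convex (t : 𝕜) C₁₁ C₁₂ C₂₁ C₂₂, ← hsum]
  refine ((h11.add h22).smul_of_nonneg ?_).add (hC.smul_of_nonneg ?_)
  · have : ((1 - t : ℝ) : 𝕜) = 1 - (t : 𝕜) := by push_cast; ring
    rw [← this]
    exact RCLike.ofReal_nonneg.mpr (by linarith)
  · exact RCLike.ofReal_nonneg.mpr ht0

omit [CompleteSpace E] in
/-- A positive INVERTIBLE bounded operator has a positive inverse: `C = 1/Δ⁰_B` is positive with `Δ⁰_B` (⟪B⁻¹x, x⟫ = ⟪y, By⟫ with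
`x = By`). [cite: MagnenRivasseauSeneor1993, Sect. V (V.8) p.361] -/
theorem isPositive_units_inv (B : (E →L[𝕜] E)ˣ) (hB : (B : E →L[𝕜] E).IsPositive) : (↑B⁻¹ : E →L[𝕜] E).IsPositive := by
  rw [ContinuousLinearMap.isPositive_iff]
  have hxy : ∀ x : E, (B : E →L[𝕜] E) ((↑B⁻¹ : E →L[𝕜] E) x) = x := fun x => by
    show ((B : E →L[𝕜] E) * ↑B⁻¹) x = x
    rw [Units.mul_inv]
    rfl
  refine ⟨fun x z => ?_, fun x => ?_⟩
  · -- symmetry: ⟪B⁻¹x, z⟫ = ⟪B⁻¹x, B(B⁻¹z)⟫ = ⟪B(B⁻¹x), B⁻¹z⟫ = ⟪x, B⁻¹z⟫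
    have h := hB.inner_left_eq_inner_right ((↑B⁻¹ : E →L[𝕜] E) x) ((↑B⁻¹ : E →L[𝕜] E) z)
    rw [hxy, hxy] at h
    simpa using h.symm
  · have h := hB.inner_nonneg_right ((↑B⁻¹ : E →L[𝕜] E) x)
    rwa [hxy] at h

/-- `C₁₁ = X B X† = χ_CSFR Γ Δ⁰_B Γ χ_CSFR` is positive with `Δ⁰_B`. [cite: MagnenRivasseauSeneor1993, Sect. V (V.8) p.361 tl.12] -/
theorem isPositive_C11 {B : E →L[𝕜] E} (hB : B.IsPositive) (X : E →L[𝕜] E) : (X * B * X†).IsPositive := by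
  rw [mul_assoc]
  simpa [ContinuousLinearMap.mul_def] using hB.conj_adjoint X

/-- `C₂₂ = Y B⁻¹ Y† = [χ_CSFR Γ′ + χ_ELFR](1/Δ⁰_B)[Γ′χ_CSFR + χ_ELFR]` is positive with `1/Δ⁰_B`.
[cite: MagnenRivasseauSeneor1993, Sect. V (V.8) p.361 tl.12] -/
theorem isPositive_C22 (B : (E →L[𝕜] E)ˣ) (hB : (B : E →L[𝕜] E).IsPositive) (Y : E →L[𝕜] E) :
    (Y * ↑B⁻¹ * Y†).IsPositive := by
  rw [mul_assoc]
  simpa [ContinuousLinearMap.mul_def] using (isPositive_units_inv B hB).conj_adjoint Y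

/-- **p.361 tl.10–12 for the (V.8) pieces** — *«we write C(t) = C₁₁ + tC₁₂ + tC₂₁ + C₂₂. This is still a positive operator since
C₁₁ and C₂₂ are positive»* — PROVED: for a positive invertible `B = Δ⁰_B` and ANY stopped left expansion `B⁻¹ = X + Y B⁻¹` (hence, by
`right_of_left_star`, the symmetric right expansion `B⁻¹ = X† + B⁻¹Y†`), the pieces `C₁₁ = XBX†`, `C₁₂ = XY†`, `C₂₁ = YX†`,
`C₂₂ = YB⁻¹Y†` sum to `C = B⁻¹` (`two_sided_expansion`) and `C(t)` is a positive operator for every `t ∈ [0,1]`.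
[cite: MagnenRivasseauSeneor1993, Sect. V (V.8) and p.361 tl.10–12] -/
theorem isPositive_interp_of_stoppedExpansion (B : (E →L[𝕜] E)ˣ) (hB : (B : E →L[𝕜] E).IsPositive) {X Y : E →L[𝕜] E}
    (hL : (↑B⁻¹ : E →L[𝕜] E) = X + Y * ↑B⁻¹) {t : ℝ} (ht0 : 0 ≤ t) (ht1 : t ≤ 1) :
    (X * ↑B * X† + (t : 𝕜) • (X * Y†) + (t : 𝕜) • (Y * X†) + Y * ↑B⁻¹ * Y†).IsPositive := by
  have hBsa : star (B : E →L[𝕜] E) = B := by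
    rw [ContinuousLinearMap.star_eq_adjoint]
    exact hB.isSelfAdjoint.adjoint_eq
  have hR : (↑B⁻¹ : E →L[𝕜] E) = X† + ↑B⁻¹ * Y† := by
    simpa [ContinuousLinearMap.star_eq_adjoint] using right_of_left_star B hBsa hL
  have hsum := two_sided_expansion B hL hR
  exact isPositive_interp hsum (isPositive_units_inv B hB) (isPositive_C11 hB X) (isPositive_C22 B hB Y) ht0 ht1

/-- (V.8) for operators, from the left expansion alone: for self-adjoint invertible `B` and `B⁻¹ = X + Y B⁻¹`,
`B⁻¹ = XBX† + XY† + YX† + YB⁻¹Y†` (the right expansion being the adjoint one). [cite: MagnenRivasseauSeneor1993, Sect. V (V.8) p.361] -/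
theorem displayV8_of_stoppedExpansion (B : (E →L[𝕜] E)ˣ) (hB : (B : E →L[𝕜] E).IsPositive) {X Y : E →L[𝕜] E}
    (hL : (↑B⁻¹ : E →L[𝕜] E) = X + Y * ↑B⁻¹) :
    (↑B⁻¹ : E →L[𝕜] E) = X * ↑B * X† + X * Y† + Y * X† + Y * ↑B⁻¹ * Y† := by
  have hBsa : star (B : E →L[𝕜] E) = B := by
    rw [ContinuousLinearMap.star_eq_adjoint]
    exact hB.isSelfAdjoint.adjoint_eq
  have hR : (↑B⁻¹ : E →L[𝕜] E) = X† + ↑B⁻¹ * Y† := by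
    simpa [ContinuousLinearMap.star_eq_adjoint] using right_of_left_star B hBsa hL
  exact two_sided_expansion B hL hR

/-- The interval matters: already for `1 × 1` real data (`B = 1`, `X = Y = 1/2`, so that `B⁻¹ = X + YB⁻¹` holds and
`C₁₁ = C₁₂ = C₂₁ = C₂₂ = 1/4`) the expression `C(t) = 1/2 + t/2` is negative at `t = −2`; positivity of `C₁₁`, `C₂₂` alone is
used together with `0 ≤ t ≤ 1` and `C ≥ 0`. [cite: MagnenRivasseauSeneor1993, Sect. V p.361 tl.10–12] -/
theorem interp_neg_example :
    ∃ b x y t : ℝ, 0 < b ∧ b⁻¹ = x + y * b⁻¹ ∧ x * b * x + t * (x * y) + t * (y * x) + y * b⁻¹ * y < 0 :=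
  ⟨1, 1 / 2, 1 / 2, -2, one_pos, by norm_num, by norm_num⟩

end Positive

/-! ## §4 «Then we perform a first order Taylor expansion in this parameter» -/

section Taylor

variable {V : Type*} [NormedAddCommGroup V] [NormedSpace ℝ V]

/-- `t ↦ C(t) = C₁₁ + tC₁₂ + tC₂₁ + C₂₂` is differentiable with derivative `C₁₂ + C₂₁` — the «explicit C₁₂ or C₂₁ link» the
interpolating terms contain (p.361 tl.14). [cite: MagnenRivasseauSeneor1993, Sect. V p.361 tl.12–14] -/
theorem hasDerivAt_interp (C₁₁ C₁₂ C₂₁ C₂₂ : V) (t₀ : ℝ) :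
    HasDerivAt (fun t : ℝ => C₁₁ + t • C₁₂ + t • C₂₁ + C₂₂) (C₁₂ + C₂₁) t₀ := by
  have h : HasDerivAt (fun t : ℝ => t • (C₁₂ + C₂₁)) ((1 : ℝ) • (C₁₂ + C₂₁)) t₀ :=
    (hasDerivAt_id t₀).smul_const _
  rw [one_smul] at h
  have h2 := (h.const_add (C₁₁ + C₂₂))
  convert h2 using 1
  funext t
  rw [interp_eq_affine]

/-- The first-order Taylor formula is EXACT for the affine path: `C(1) = C(0) + (C₁₂ + C₂₁)`.
[cite: MagnenRivasseauSeneor1993, Sect. V p.361 tl.12–13] -/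
theorem interp_one_eq_zero_add (C₁₁ C₁₂ C₂₁ C₂₂ : V) :
    C₁₁ + (1 : ℝ) • C₁₂ + (1 : ℝ) • C₂₁ + C₂₂ = (C₁₁ + (0 : ℝ) • C₁₂ + (0 : ℝ) • C₂₁ + C₂₂) + (C₁₂ + C₂₁) := by
  simp only [one_smul, zero_smul, add_zero]
  abel

/-- «a first order Taylor expansion in this parameter» for a functional `g(t)` of `C(t)` (in the paper a Gaussian integral with
covariance `C(t)`): `g(1) = g(0) + ∫₀¹ g′(t) dt` whenever `g` has the derivative `g′` on `[0,1]` and `g′` is integrable there —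
the fundamental theorem of calculus (Mathlib `intervalIntegral.integral_eq_sub_of_hasDerivAt`); the «decoupled term at t = 0» is
`g(0)`, the «interpolating terms» are the integral. [cite: MagnenRivasseauSeneor1993, Sect. V p.361 tl.12–20] -/
theorem taylor_first_order {g g' : ℝ → ℝ} (hg : ∀ t ∈ Set.uIcc (0 : ℝ) 1, HasDerivAt g (g' t) t)
    (hint : IntervalIntegrable g' volume 0 1) : g 1 = g 0 + ∫ t in (0 : ℝ)..1, g' t := by
  rw [intervalIntegral.integral_eq_sub_of_hasDerivAt hg hint]
  ring

end Taylor

/-! ## §5 (EDITION v1.1) Sect. V.B: (V.9), (V.12) and «symmetrically from both sides of C₂₂ in order to preserve positivity» -/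

section SectVB

variable {R : Type*} [Ring R]

/-- **(V.9)** p.362 [PDF 38]: *«We insert a first resolvent step which is χ_ELFR (1/Δ⁰_B) = χ_ELFR [1/Δ_B^{0,∅} + (1/Δ_B^{0,∅})(Δ_B^{0,∅} −
Δ⁰_B)(1/Δ⁰_B)]. (V.9)»* — in any ring, for units `A₀ = Δ_B^{0,∅}`, `B = Δ⁰_B` and any element `P = χ_ELFR` (file 52's left step).
[cite: MagnenRivasseauSeneor1993, Sect. V (V.9) p.362] -/
theorem displayV9 (A₀ B : Rˣ) (P : R) :
    P * (↑B⁻¹ : R) = P * (↑A₀⁻¹ + ↑A₀⁻¹ * ((A₀ : R) - B) * ↑B⁻¹) := by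
  have h : (↑B⁻¹ : R) = ↑A₀⁻¹ + ↑A₀⁻¹ * ((A₀ : R) - B) * ↑B⁻¹ := by
    have h0 := ResolventExpansion.inv_eq_inv_mul_one_add A₀ B
    rw [mul_add, mul_one, ← mul_assoc] at h0
    exact h0
  rw [← h]

/-- The step from `Δ_B^{0,∅}` to `Δ_B^{0,1}`: `1/Δ_B^{0,1} = 1/Δ_B^{0,∅} + (1/Δ_B^{0,1})(Δ_B^{0,∅} − Δ_B^{0,1})(1/Δ_B^{0,∅})` (the first two
terms of (V.12); file 52's (V.1) in the mirror form). [cite: MagnenRivasseauSeneor1993, Sect. V (V.12) p.363] -/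
theorem inv_two_step (A₀ A₁ : Rˣ) : (↑A₁⁻¹ : R) = ↑A₀⁻¹ + ↑A₁⁻¹ * ((A₀ : R) - A₁) * ↑A₀⁻¹ := by
  rw [mul_sub, sub_mul, Units.mul_inv_cancel_right, Units.inv_mul, one_mul]
  abel

/-- (V.12) is the product of the two one-step brackets: `[1/Δ_B^{0,∅} + (1/Δ_B^{0,1})(Δ_B^{0,∅} − Δ_B^{0,1})(1/Δ_B^{0,∅})]·[1 + (Δ_B^{0,1} −
Δ⁰_B)(1/Δ⁰_B)] = 1/Δ⁰_B`, the first bracket being `1/Δ_B^{0,1}` («applying (V.9) for i = 1»).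
[cite: MagnenRivasseauSeneor1993, Sect. V (V.9), (V.12) pp.362–363] -/
theorem displayV12_eq_twoFactor (A₀ A₁ B : Rˣ) :
    (↑A₀⁻¹ + ↑A₁⁻¹ * ((A₀ : R) - A₁) * ↑A₀⁻¹) * (1 + ((A₁ : R) - B) * ↑B⁻¹) = (↑B⁻¹ : R) := by
  rw [← inv_two_step A₀ A₁, ← ResolventExpansion.inv_eq_inv_mul_one_add A₁ B]

/-- **(V.12)** p.363 [PDF 39]: *«χ₁ (1/Δ⁰_B) = χ₁ [1/Δ_B^{0,∅} + (1/Δ_B^{0,1})(Δ_B^{0,∅} − Δ_B^{0,1})(1/Δ_B^{0,∅}) + (1/Δ_B^{0,∅})(Δ_B^{0,1} −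
Δ⁰_B)(1/Δ⁰_B) + (1/Δ_B^{0,1})(Δ_B^{0,∅} − Δ_B^{0,1})(1/Δ_B^{0,∅})(Δ_B^{0,1} − Δ⁰_B)(1/Δ⁰_B)]. (V.12)»* — PROVED in any ring for units
`A₀ = Δ_B^{0,∅}`, `A₁ = Δ_B^{0,1}`, `B = Δ⁰_B` and any `P = χ₁` (the last difference is printed «Δ_B^{0,ı} − Δ⁰_B» [sic]; read «Δ_B^{0,1}»,
with which the identity holds). [cite: MagnenRivasseauSeneor1993, Sect. V (V.12) p.363] -/
theorem displayV12 (A₀ A₁ B : Rˣ) (P : R) :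
    P * (↑B⁻¹ : R) = P * (↑A₀⁻¹ + ↑A₁⁻¹ * ((A₀ : R) - A₁) * ↑A₀⁻¹ + ↑A₀⁻¹ * ((A₁ : R) - B) * ↑B⁻¹ +
      ↑A₁⁻¹ * ((A₀ : R) - A₁) * ↑A₀⁻¹ * ((A₁ : R) - B) * ↑B⁻¹) := by
  have key : (↑A₀⁻¹ + ↑A₁⁻¹ * ((A₀ : R) - A₁) * ↑A₀⁻¹) * (1 + ((A₁ : R) - B) * ↑B⁻¹) =
      ↑A₀⁻¹ + ↑A₁⁻¹ * ((A₀ : R) - A₁) * ↑A₀⁻¹ + ↑A₀⁻¹ * ((A₁ : R) - B) * ↑B⁻¹ +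
        ↑A₁⁻¹ * ((A₀ : R) - A₁) * ↑A₀⁻¹ * ((A₁ : R) - B) * ↑B⁻¹ := by
    simp only [add_mul, mul_add, mul_one, mul_assoc]
    abel
  rw [← key, displayV12_eq_twoFactor]

end SectVB

section SInterp

variable {S R : Type*} [CommRing S] [Ring R] [Algebra S R]

/-- **«Then we multiply the differences Δ_B^{0,1} − Δ⁰_B by an interpolation parameter s₁»** (p.363 tl.38): the interpolated one-sided
bracket `(1/Δ_B^{0,1})[1 + s₁(Δ_B^{0,1} − Δ⁰_B)(1/Δ⁰_B)]` equals the CONVEX COMBINATION `(1 − s₁)·(1/Δ_B^{0,1}) + s₁·(1/Δ⁰_B)` — in any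
algebra over a commutative ring of scalars. [cite: MagnenRivasseauSeneor1993, Sect. V (V.12) p.363 tl.36–37, tl.38–39] -/
theorem sInterp_eq_convex (A₁ B : Rˣ) (s : S) :
    (↑A₁⁻¹ : R) * (1 + s • (((A₁ : R) - B) * ↑B⁻¹)) = (1 - s) • (↑A₁⁻¹ : R) + s • (↑B⁻¹ : R) := by
  -- the difference of the two inverses IS the remainder term: `B⁻¹ − A₁⁻¹ = A₁⁻¹(A₁ − B)B⁻¹` (the tree's generic
  -- `…Balaban1983to89.T4TwoSpacingDefect.inv_sub_inv_eq_twoSpacing`; re-derived locally rather than importing that module)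
  have hdiff : (↑B⁻¹ : R) - ↑A₁⁻¹ = ↑A₁⁻¹ * ((A₁ : R) - B) * ↑B⁻¹ := by
    rw [mul_sub, sub_mul, Units.inv_mul, one_mul, Units.mul_inv_cancel_right]
  rw [mul_add, mul_one, mul_smul_comm, ← mul_assoc, ← hdiff, smul_sub, sub_smul, one_smul]
  abel

/-- At `s₁ = 0` the bracket is `1/Δ_B^{0,1}` (E₁ decoupled: «with E₁ and E_j joined together» only in the remainder).
[cite: MagnenRivasseauSeneor1993, Sect. V p.363 tl.38–40] -/
theorem sInterp_zero (A₁ B : Rˣ) : (↑A₁⁻¹ : R) * (1 + (0 : S) • (((A₁ : R) - B) * ↑B⁻¹)) = ↑A₁⁻¹ := by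
  rw [zero_smul, add_zero, mul_one]

/-- At `s₁ = 1` the bracket is the full `1/Δ⁰_B` ((V.9) with `i = 1`). [cite: MagnenRivasseauSeneor1993, Sect. V (V.9), (V.12) pp.362–363] -/
theorem sInterp_one (A₁ B : Rˣ) : (↑A₁⁻¹ : R) * (1 + (1 : S) • (((A₁ : R) - B) * ↑B⁻¹)) = ↑B⁻¹ := by
  rw [one_smul, ← ResolventExpansion.inv_eq_inv_mul_one_add A₁ B]

end SInterp

section SInterpAnalysis

variable {V : Type*} [NormedAddCommGroup V] [NormedSpace ℝ V]

/-- «Taylor expand to first order» in `s₁`: the convex path `s ↦ (1 − s)·A₁⁻¹ + s·B⁻¹` has derivative `B⁻¹ − A₁⁻¹` — i.e.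
the difference term `(1/Δ_B^{0,1})(Δ_B^{0,1} − Δ⁰_B)(1/Δ⁰_B)`. [cite: MagnenRivasseauSeneor1993, Sect. V p.363 tl.38–40] -/
theorem hasDerivAt_sInterp (Ainv Binv : V) (s₀ : ℝ) :
    HasDerivAt (fun s : ℝ => (1 - s) • Ainv + s • Binv) (Binv - Ainv) s₀ := by
  have h1 : HasDerivAt (fun s : ℝ => (1 - s) • Ainv) ((-1 : ℝ) • Ainv) s₀ := by
    exact ((hasDerivAt_id s₀).const_sub 1).smul_const Ainv
  have h2 : HasDerivAt (fun s : ℝ => s • Binv) ((1 : ℝ) • Binv) s₀ := (hasDerivAt_id s₀).smul_const Binv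
  have h := h1.add h2
  rw [neg_smul, one_smul, one_smul, neg_add_eq_sub] at h
  exact h

end SInterpAnalysis

section SymmetricPositivity

open scoped InnerProduct ComplexOrder

variable {𝕜 E : Type*} [RCLike 𝕜] [NormedAddCommGroup E] [InnerProductSpace 𝕜 E] [CompleteSpace E]

/-- **«we need to do it symmetrically from both sides of C₂₂ in order to preserve positivity»** (p.363 tl.32–33): expanding `1/Δ⁰_B`
as `1/Δ⁰_B · Δ⁰_B · 1/Δ⁰_B` «as in (V.6)» and replacing the outer inverses by the SAME bracket `L` on the left and its adjoint on the right
gives `L · Δ⁰_B · L†`, a positive operator for EVERY bounded `L` — in particular for the `s₁`-interpolated bracket at every real `s₁`,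
with no restriction on `s₁`. [cite: MagnenRivasseauSeneor1993, Sect. V p.363 tl.32–35; (V.6) p.359] -/
theorem isPositive_symmetric_sandwich {B : E →L[𝕜] E} (hB : B.IsPositive) (L : E →L[𝕜] E) : (L * B * L†).IsPositive :=
  isPositive_C11 hB L

omit [CompleteSpace E] in
/-- The ONE-SIDED interpolated bracket `(1 − s₁)·(1/Δ_B^{0,1}) + s₁·(1/Δ⁰_B)` (`sInterp_eq_convex`) is itself a positive operator when
`1/Δ_B^{0,1}` and `1/Δ⁰_B` are and `s₁ ∈ [0,1]` — but only on that interval, which is why the paper symmetrises.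
[cite: MagnenRivasseauSeneor1993, Sect. V p.363 tl.32–40] -/
theorem isPositive_sInterp {Ainv Binv : E →L[𝕜] E} (hA : Ainv.IsPositive) (hB : Binv.IsPositive) {s : ℝ} (hs0 : 0 ≤ s)
    (hs1 : s ≤ 1) : (((1 - s : ℝ) : 𝕜) • Ainv + (s : 𝕜) • Binv).IsPositive :=
  (hA.smul_of_nonneg (RCLike.ofReal_nonneg.mpr (by linarith))).add (hB.smul_of_nonneg (RCLike.ofReal_nonneg.mpr hs0))

end SymmetricPositivity

end Decoupling

end Literature.MathematicalPhysics.QuantumFieldTheory.MagnenRivasseauSeneor1993
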